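import Summits.Parity.GeneralizedHardyLittlewood.Theorems.FordMaynardNoSieveConst0164NegWitness0164Witness

/-!
# Route `FordMaynardNoSieveConst0164`, crux `NegWitness0164` (stmt-Parity-19102), line `birth`,
# stub `stub_tweakNeg0164`: the dimension-5 table as a symmetric cell step function ((W5) discharged)

Helper file toward the certificate stub (K. Ford, J. Maynard, *On the theory of prime producing sieves*,
arXiv:2407.14368, §8; the cell's certificate format CERT-FORMAT.md §1: `F₀⁽⁵⁾` piecewise constant on products of the
cells `[e_j, e_{j+1})`, `e_j = ν + j·w`, `ν = 41/250`, `w = 7/500`, `j < 24`, nonzero only on cell tuples all of whose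
pairs of upper edges sum to `≤ 1/2`).  For ANY table `c : (Fin 5 → Fin 24) → ℝ` that is invariant under permuting the
five indices, nonnegative, and vanishes on tuples with a pair of upper cell edges summing to `> 1/2`, the function
`G⁽⁵⁾(x) = Σ_t c(t)·𝟙[x ∈ cell box t, Σ x = 1]` (zero in other dimensions) has every property required by
`stub_tweakNeg0164_of_table` (`…Witness`):

* `cellFn`-lemmas (written for the lambda; no definition): symmetric, piecewise Lipschitz
  (`IsPiecewiseLipschitz'.finset_sum` of simplex-box steps), nonnegative, supported in `{x ≥ ν, Σ x = 1}`, zero at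
  vectors with a pair `≥ 1/2`;
* `stub_tweakNeg0164_of_cellTable` — **the stub from a cell table `c` and the two inequalities (I), (II)** written
  for `G⁽⁵⁾ = Σ_t c(t)·𝟙[cell t ∩ {Σ = 1}]`.

Def-free.  References: [FordMaynard2024PrimeSieves] arXiv:2407.14368, §8, Definition 6.2 (b).
-/

noncomputable section

open Finset MeasureTheory Set
open scoped Classical
open Literature.NumberTheory.Sieve Literature.NumberTheory.Sieve.FordMaynard

namespace Summit.Parity.GeneralizedHardyLittlewood.FordMaynardNoSieveConst0164NegWitness0164

/-- `box ∩ {Σ x = 1}` is polyhedral (vector bounds). [folklore] -/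
theorem isPolyhedral_simplexBox' (k : ℕ) (lo hi : Fin k → ℝ) :
    IsPolyhedral {x : Fin k → ℝ | (∀ i, lo i ≤ x i ∧ x i < hi i) ∧ ∑ i, x i = 1} := by
  refine IsPolyhedral.setOf_and (isPolyhedral_halfOpenBox k lo hi) ?_
  set φ : (Fin k → ℝ) →ₗ[ℝ] ℝ := ∑ t, LinearMap.proj t with hφ
  have hφapp : ∀ ξ : Fin k → ℝ, φ ξ = ∑ t, ξ t := fun ξ => by rw [hφ, LinearMap.sum_apply]; rfl
  have := (isPolyhedral_le φ 1).inter (isPolyhedral_ge φ 1)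
  convert this using 1
  ext ξ
  simp only [Set.mem_setOf_eq, Set.mem_inter_iff, hφapp]
  constructor
  · intro h; exact ⟨h.le, h.ge⟩
  · intro h; exact le_antisymm h.1 h.2

/-- Finite sums of constants on `box ∩ {Σ x = 1}` are piecewise Lipschitz. [cite: FordMaynard2024PrimeSieves, Definition 6.2 (b)] -/
theorem isPiecewiseLipschitz_sum_const_simplexBox (k : ℕ) {κ : Type*} (s : Finset κ)
    (lo hi : κ → Fin k → ℝ) (c : κ → ℝ) :
    IsPiecewiseLipschitz (fun x : Fin k → ℝ =>
      ∑ j ∈ s, (if (∀ i, lo j i ≤ x i ∧ x i < hi j i) ∧ ∑ i, x i = 1 then c j else 0)) := by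
  refine (IsPiecewiseLipschitz'.finset_sum s fun j _ => ?_).isPiecewiseLipschitz
  refine ⟨Unit, inferInstance, fun _ => {x : Fin k → ℝ | (∀ i, lo j i ≤ x i ∧ x i < hi j i) ∧ ∑ i, x i = 1},
    fun _ x => if (∀ i, lo j i ≤ x i ∧ x i < hi j i) ∧ ∑ i, x i = 1 then c j else 0,
    fun _ => ⟨isPolyhedral_simplexBox' k (lo j) (hi j), (isBounded_halfOpenBox k (lo j) (hi j)).subset fun x hx => hx.1,
      fun x hx => if_neg hx, ⟨0, ?_⟩⟩, fun x => by simp⟩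
  · refine LipschitzOnWith.of_dist_le_mul fun x hx y hy => ?_
    have hx' : (∀ i, lo j i ≤ x i ∧ x i < hi j i) ∧ ∑ i, x i = 1 := hx
    have hy' : (∀ i, lo j i ≤ y i ∧ y i < hi j i) ∧ ∑ i, y i = 1 := hy
    show dist (if (∀ i, lo j i ≤ x i ∧ x i < hi j i) ∧ ∑ i, x i = 1 then c j else 0)
      (if (∀ i, lo j i ≤ y i ∧ y i < hi j i) ∧ ∑ i, y i = 1 then c j else 0) ≤ _
    rw [if_pos hx', if_pos hy', dist_self]
    simp

/-- **`stub_tweakNeg0164` from a symmetric cell table.** Cells: `[e_j, e_{j+1})`, `e_j = 41/250 + j·(7/500)`,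
`j < 24`. Let `c : (Fin 5 → Fin 24) → ℝ` be invariant under permutations of the five indices, nonnegative, and zero
on every tuple `t` having two indices `i ≠ j` with `e_{t i + 1} + e_{t j + 1} > 1/2`. Put
`G⁽⁵⁾(x) = Σ_t c(t) 𝟙[e_{tᵢ} ≤ xᵢ < e_{tᵢ+1} ∀ i, Σ x = 1]`. If (I) and (II) of `stub_tweakNeg0164_of_table` hold for
this `G⁽⁵⁾`, then `stub_tweakNeg0164` holds. [cite: FordMaynard2024PrimeSieves, §8 (proof of Theorem 2.7 (c))] -/
theorem stub_tweakNeg0164_of_cellTable (c : (Fin 5 → Fin 24) → ℝ)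
    (hcs : ∀ (σ : Equiv.Perm (Fin 5)) (t : Fin 5 → Fin 24), c (t ∘ σ) = c t)
    (hc0 : ∀ t, 0 ≤ c t)
    (hcpair : ∀ t, c t ≠ 0 → ∀ i j : Fin 5, i ≠ j →
      (41 / 250 + ((t i : ℕ) + 1) * (7 / 500) : ℝ) + (41 / 250 + ((t j : ℕ) + 1) * (7 / 500)) ≤ 1 / 2)
    (hI : 1 < 1 / 3 * sliceIntegral 3 1 (fun v => if (∀ t, (41 / 250 : ℝ) ≤ v t) ∧ (∀ t, v t < 1 / 2) then
          1 / (v 0 * v 1 * v 2) else 0) +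
        1 / 20 * sliceIntegral 5 1 (fun v => if ∀ t, (41 / 250 : ℝ) ≤ v t then
          (∑ t : Fin 5 → Fin 24, (if (∀ i, (41 / 250 + (t i : ℕ) * (7 / 500) : ℝ) ≤ v i ∧
              v i < 41 / 250 + ((t i : ℕ) + 1) * (7 / 500)) ∧ ∑ i, v i = 1 then c t else 0)) /
            (v 0 * v 1 * v 2 * v 3 * v 4) else 0))
    (hII : ∀ b : Fin 2 → ℝ, (∀ i, (41 / 250 : ℝ) ≤ b i) → (∀ i, b i < 1 / 2) → ∑ i, b i ≤ 1 / 2 →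
      (1 - ∑ i, b i) / 6 * sliceIntegral 3 (1 - ∑ i, b i) (fun v => if ∀ t, (41 / 250 : ℝ) ≤ v t then
          (∑ t : Fin 5 → Fin 24, (if (∀ i, (41 / 250 + (t i : ℕ) * (7 / 500) : ℝ) ≤ (Fin.append v b) i ∧
              (Fin.append v b) i < 41 / 250 + ((t i : ℕ) + 1) * (7 / 500)) ∧ ∑ i, (Fin.append v b) i = 1
              then c t else 0)) / (v 0 * v 1 * v 2) else 0) ≤
        1 + (1 - ∑ i, b i) / 2 * sliceIntegral 2 (1 - ∑ i, b i) (fun v =>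
          if (∀ i, (41 / 250 : ℝ) ≤ v i) ∧ (∀ i, v i < 1 / 2) then 1 / (v 0 * v 1) else 0)) :
    ∃ F₀ : VecFn, F₀.IsSymmetric ∧ (∀ k, IsPiecewiseLipschitz (F₀ k)) ∧
      (∀ (k : ℕ) (ξ : Fin k → ℝ), F₀ k ξ ≠ 0 → (∀ i, (41 / 250 : ℝ) ≤ ξ i) ∧ ∑ i, ξ i = 1) ∧
      tweak (1 / 2) (41 / 250) Fin.elim0 Fin.elim0 F₀ 1 (fun _ => 1) < -1 ∧
      ∀ k : ℕ, 2 ≤ k → ∀ β : Fin k → ℝ, -1 ≤ tweak (1 / 2) (41 / 250) Fin.elim0 Fin.elim0 F₀ k β := by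
  -- the dimension-5 function and its embedding as a `VecFn`
  set G5 : (Fin 5 → ℝ) → ℝ := fun x => ∑ t : Fin 5 → Fin 24,
    (if (∀ i, (41 / 250 + (t i : ℕ) * (7 / 500) : ℝ) ≤ x i ∧ x i < 41 / 250 + ((t i : ℕ) + 1) * (7 / 500)) ∧
      ∑ i, x i = 1 then c t else 0) with hG5
  set G : VecFn := fun k x => if h : k = 5 then G5 (fun i => x (Fin.cast h.symm i)) else 0 with hG
  have hGk : ∀ k, k ≠ 5 → ∀ x, G k x = 0 := fun k hk x => by simp only [hG, dif_neg hk]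
  have hG5' : ∀ x : Fin 5 → ℝ, G 5 x = G5 x := fun x => by simp only [hG, dif_pos rfl]; rfl
  -- properties of `G5`
  have hsymm : ∀ (σ : Equiv.Perm (Fin 5)) (x : Fin 5 → ℝ), G5 (x ∘ σ) = G5 x := by
    intro σ x
    simp only [hG5]
    -- reindex the sum by `t ↦ t ∘ σ`
    rw [← Equiv.sum_comp (Equiv.arrowCongr σ (Equiv.refl (Fin 24))).symm]
    refine Finset.sum_congr rfl fun t _ => ?_
    have ht : ((Equiv.arrowCongr σ (Equiv.refl (Fin 24))).symm t) = t ∘ σ := by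
      funext i; simp [Equiv.arrowCongr]
    rw [ht, hcs σ t, show ∑ i, (x ∘ σ) i = ∑ i, x i from Equiv.sum_comp σ x]
    have hiff : (∀ i, (41 / 250 + ((t ∘ σ) i : ℕ) * (7 / 500) : ℝ) ≤ (x ∘ σ) i ∧
        (x ∘ σ) i < 41 / 250 + (((t ∘ σ) i : ℕ) + 1) * (7 / 500)) ↔
        (∀ i, (41 / 250 + (t i : ℕ) * (7 / 500) : ℝ) ≤ x i ∧ x i < 41 / 250 + ((t i : ℕ) + 1) * (7 / 500)) :=
      ⟨fun h i => by simpa using h (σ.symm i), fun h i => h (σ i)⟩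
    simp only [hiff]
  have hnonneg : ∀ x, 0 ≤ G5 x := fun x =>
    Finset.sum_nonneg fun t _ => by split_ifs <;> [exact hc0 t; exact le_rfl]
  have hterm_zero : ∀ (x : Fin 5 → ℝ) (t : Fin 5 → Fin 24),
      (¬ ((∀ i, (41 / 250 + (t i : ℕ) * (7 / 500) : ℝ) ≤ x i ∧ x i < 41 / 250 + ((t i : ℕ) + 1) * (7 / 500)) ∧
        ∑ i, x i = 1) ∨ c t = 0) →
      (if (∀ i, (41 / 250 + (t i : ℕ) * (7 / 500) : ℝ) ≤ x i ∧ x i < 41 / 250 + ((t i : ℕ) + 1) * (7 / 500)) ∧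
        ∑ i, x i = 1 then c t else 0) = 0 := by
    intro x t h
    rcases h with h | h
    · exact if_neg h
    · simp [h]
  have hsupp : ∀ x, G5 x ≠ 0 → (∀ i, (41 / 250 : ℝ) ≤ x i) ∧ ∑ i, x i = 1 := by
    intro x hx
    by_contra hnot
    apply hx
    refine Finset.sum_eq_zero fun t _ => hterm_zero x t (Or.inl fun h => hnot ⟨fun i => ?_, h.2⟩)
    have := (h.1 i).1
    have h0 : (0 : ℝ) ≤ (t i : ℕ) * (7 / 500) := by positivity
    linarith
  have hpair : ∀ (x : Fin 5 → ℝ) (i j : Fin 5), i ≠ j → 1 / 2 ≤ x i + x j → G5 x = 0 := by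
    intro x i j hij hx
    refine Finset.sum_eq_zero fun t _ => hterm_zero x t ?_
    by_cases hct : c t = 0
    · exact Or.inr hct
    · refine Or.inl fun h => ?_
      have hi := (h.1 i).2
      have hj := (h.1 j).2
      have := hcpair t hct i j hij
      linarith
  have hpl : IsPiecewiseLipschitz G5 :=
    isPiecewiseLipschitz_sum_const_simplexBox 5 Finset.univ
      (fun t i => (41 / 250 + (t i : ℕ) * (7 / 500) : ℝ)) (fun t i => 41 / 250 + ((t i : ℕ) + 1) * (7 / 500)) c
  refine stub_tweakNeg0164_of_table G hGk (fun σ x => by rw [hG5', hG5', hsymm])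
    (by rw [show G 5 = G5 from funext hG5']; exact hpl) (fun x => by rw [hG5']; exact hnonneg x)
    (fun x hx => hsupp x (by rwa [hG5'] at hx)) (fun x i j hij h => by rw [hG5']; exact hpair x i j hij h)
    ?_ ?_
  · simp only [hG5']
    exact hI
  · intro b hb hb' hbs
    have h5 : ∀ v : Fin 3 → ℝ, G (3 + 2) (Fin.append v b) = G5 (Fin.append v b) := fun v => hG5' _
    simp only [h5]
    exact hII b hb hb' hbs

end Summit.Parity.GeneralizedHardyLittlewood.FordMaynardNoSieveConst0164NegWitness0164

end
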